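import Summits.QuantumAdvantage.QuantumAdvantage.Theses.WhiteBoxWalk
import Summits.QuantumAdvantage.QuantumAdvantage.Theorems.WhiteBoxWalkWbwSearchToPromise

/-!
# Route `WhiteBoxWalk`, assembly item `Assembly` (stmt-QuantumAdvantage-2241)

`Assembly := X → PL → QuantumAdvantage`, with the antecedents `X = WbwThesis` (planted
unique-answer white-box quantum advantage) and `PL = WbwPromiseLift`
(`BQP ⊆ BPP → PromiseBQP ⊆ PromiseBPP'`) inlined verbatim.

Proof: if the summit `∃ L, L ∈ BQP ∧ L ∉ BPP` fails then `BQP ⊆ BPP`, so `PL` gives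
`PromiseBQP ⊆ PromiseBPP'`, contradicting the glue `WbwSearchToPromise : X → ¬ (PromiseBQP ⊆
PromiseBPP')` proved in the tree (`wbwSearchToPromise_proof`, stmt-QuantumAdvantage-2240).
Classical propositional logic; no new definitions.
-/

namespace Summit.QuantumAdvantage.QuantumAdvantage.Theorems.WhiteBoxWalk

/-- **Assembly of route `WhiteBoxWalk`** (stmt-QuantumAdvantage-2241): planted unique-answer
white-box quantum advantage `X`, together with the promise lift
`PL : BQP ⊆ BPP → PromiseBQP ⊆ PromiseBPP'`, yields the summit `QuantumAdvantage`
(`∃ L, L ∈ BQP ∧ L ∉ BPP`). If no such `L` exists then `BQP ⊆ BPP`, hence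
`PromiseBQP ⊆ PromiseBPP'` by `PL`, contradicting `wbwSearchToPromise_proof` applied to `X`.
[folklore] -/
theorem assembly_proof : Theses.WhiteBoxWalk.Assembly := by
  unfold Theses.WhiteBoxWalk.Assembly
  intro hX hPL
  classical
  by_contra hQA
  refine wbwSearchToPromise_proof hX (hPL ?_)
  intro L hL
  by_contra hn
  exact hQA ⟨L, hL, hn⟩

end Summit.QuantumAdvantage.QuantumAdvantage.Theorems.WhiteBoxWalk
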